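import Literature.Barriers.CriticalPhenomena.PlaquetteWalkAngleLimitColumnCoherence
import Literature.Barriers.CriticalPhenomena.PlaquetteWalkHoleRootExtensionCost
import Literature.Barriers.CriticalPhenomena.PlaquetteWalkHoleRootRowOnly
import Literature.Barriers.CriticalPhenomena.PlaquetteWalkHoleRootSevenTopRow
import HarnessLib

/-!
# Barrier catalogue (SAWScalingLimit): the above-coherence criterion REDUCED TO THE PHASE of the class-`B2b` members («COLUMN LAW», assembly)

`Z → ∞` limit model of the printed Yang–Baxter weights [GlazmanManolescu2019, §1, eq. (1)]; the «RECTANGLE COEFFICIENT» line of the venture lane «pcv-sawmu»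
(b-engine-1 g26). The criterion `vertexFunctional_printed_zero_set_finite_of_aboveCoherent` (#ColumnCoherence) asks, at a rooted rhombus `f₀`, that every
wound group member of limit cost `5` be ABOVE-COHERENT (slot `N`, phase index `3` or `6`). At a rhombus STRICTLY ABOVE the root row with `w.1 ≤ f₀.1` two of
its three demands are now theorems: (i) there is NO wound class-`B2a` member of cost `5` there (`ΩG.rootRow_of_cost_five`, «B2a members live on the root
row»), and (ii) the class-`B2b` members `ext₃ ω` of cost `5` have slot `N` — their parents are the cost-`7` vertical-end walks (`ΩG.cost_ext₃_eq_five_iff`),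
whose first arc in `f₀` uses `S` and not `N` (`ΩG.usesSide_S_of_cost_seven_vert_above`), so the free fourth side is `N` (★★ `ΩG.ext₃_fst_eq_N_of_above`).
Hence ★★★★ `vertexFunctional_printed_zero_set_finite_above_of_phase`: above the root row the printed vertex functional has finitely many zeros in `θ` as
soon as every wound parent with a cost-`5` extension gives that extension PHASE INDEX `3` or `6`, and one exists — the remaining content of the column law
(FINDING-YB-LEVEL5-PHASE-LAW §3: X ∈ {3, 6} at every cell above `w`). [GlazmanManolescu2019 §1 Fig. 1, eq. (1), Lemma 2.1 (eq. (CR)), Remark 2.2;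
Glazman2015WeightedSAW Lemma 3.1 (proof, pp. 6–7); CourantRobbins1958 Ch. V App. §2]
-/

noncomputable section

open private IsNS ext₃_fst z₃_spec fc_fh sides_distinctG returnSide_of_isB2a from
  Literature.Probability.RandomPlanarGeometry.YangBaxterSAWGeneralDomain

namespace Literature.Probability.RandomPlanarGeometry.SAW.YangBaxter

open Real
open Literature.Barriers.CriticalPhenomena.PlaquetteWalk

namespace ΩG

variable {D : Set Face} {w r : Face} {ω : ΩG D (w.side .W) r}

/-- The fourth side of a rhombus whose other three sides are `S` or horizontal, one of them `S`, is `N`. [cite: GlazmanManolescu2019, §1, Fig. 1] -/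
private theorem fourth_eq_N {u a b t : Side} (hS : a = .S ∨ b = .S) (hn1 : a ≠ .N) (hn2 : b ≠ .N) (hs0 : a ≠ t) (hs1 : b ≠ t)
    (hz0 : u ≠ a) (hz1 : u ≠ b) (hz2 : u ≠ t) (hz : t = .E ∨ t = .W) (hne : a ≠ b) : u = .N := by
  cases u <;> cases a <;> cases b <;> cases t <;> simp_all

/-- ★★ **THE SLOT OF A CLASS-`B2b` MEMBER ABOVE THE ROOT ROW IS `N`.** For a wound class-`B2a` walk of limit cost `7` with a vertical end and a turning first
arc at a rhombus `r` strictly above the root row, the fourth side `z₃` of `r` — the end side of the extension `ext₃ ω` — is `N`.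
[cite: GlazmanManolescu2019, §1, Fig. 1 and eq. (1); Lemma 2.1 (proof: the groups of three walks); Remark 2.2] [cite: Glazman2015WeightedSAW, Lemma 3.1 (proof, pp. 6–7)] -/
theorem ext₃_fst_eq_N_of_above (hh : holeFaceW w ∉ D) (hr : RootedFace D (w.side .W) r) (h : ω.IsB2a)
    (hA : ω.AJ hr h (toC (midPt (w.side .W))) ≠ 0) (hc : cost (slotOfSide ω.1) ω.2.mids = 7) (hz : ω.1 = .E ∨ ω.1 = .W)
    (hNS : arcKind (ω.2.sIn ω.2.firstHitG) (ω.2.sOut ω.2.firstHitG) ≠ .straight) (habove : w.2 < r.2) :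
    (ω.ext₃ hr).1 = .N := by
  obtain ⟨-, hsInF, hsOutF⟩ := fc_fh ω hr h
  have hN : IsNS ω hr := ⟨h, by rw [← hsInF, ← hsOutF]; exact hNS⟩
  rw [ext₃_fst ω hr hN]
  have hz3 := z₃_spec ω hr h
  have hd := ω.2.sides_distinctG hr h.1
  rw [ω.returnSide_of_isB2a h] at hd
  have hs0 : ω.2.sIn ω.2.firstHitG ≠ ω.1 := by rw [hsInF]; exact fun e => hd.2.1 e.symm
  have hs1 : ω.2.sOut ω.2.firstHitG ≠ ω.1 := by rw [hsOutF]; exact fun e => hd.2.2 e.symm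
  have hz0 : ω.z₃ hr h ≠ ω.2.sIn ω.2.firstHitG := by rw [hsInF]; exact hz3.1
  have hz1 : ω.z₃ hr h ≠ ω.2.sOut ω.2.firstHitG := by rw [hsOutF]; exact hz3.2.1
  have hz2 : ω.z₃ hr h ≠ ω.1 := hz3.2.2
  obtain ⟨hS, hn1, hn2⟩ := usesSide_S_of_cost_seven_vert_above hh hr h hA hc hz hNS habove
  exact fourth_eq_N hS hn1 hn2 hs0 hs1 hz0 hz1 hz2 hz (ω.2.sIn_ne_sOut (ω.fh_lt h))

end ΩG

end Literature.Probability.RandomPlanarGeometry.SAW.YangBaxter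

namespace Literature.Barriers.CriticalPhenomena.PlaquetteWalk

open Literature.Probability.RandomPlanarGeometry.SAW.YangBaxter
open Real

variable (Dl : List Face)

open Classical in
/-- ★★★★ **THE ABOVE-COHERENCE CRITERION REDUCED TO THE PHASE.** Let `a = w.side W` be a `W`-normalised hole root of `dom Dl` (hole absent) and `f₀` a rooted
rhombus STRICTLY ABOVE the root row with `w.1 ≤ f₀.1`. If every wound class-`B2a` walk `ω` at `f₀` whose first arc in `f₀` turns and whose extension `ext₃ ω`
has limit cost `5` gives that extension PHASE INDEX `3` or `6`, and at least one such walk exists, then the zero set in `θ ∈ (0, π)` of the printed-weight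
vertex functional at `f₀` is finite (at most `4·maxExp − 4` zeros). The cost-`5` class-`B2a` demand of the criterion is empty above the row
(`ΩG.rootRow_of_cost_five`) and the slot demand is `ΩG.ext₃_fst_eq_N_of_above`. [cite: GlazmanManolescu2019, Lemma 2.1 and eq. (1); Remark 2.2]
[cite: Glazman2015WeightedSAW, Lemma 3.1 (proof, pp. 6–7)] [cite: CourantRobbins1958, Ch. V Appendix §2 (the even–odd rule)] -/
theorem vertexFunctional_printed_zero_set_finite_above_of_phase {w f₀ : Face} (hh : holeFaceW w ∉ dom Dl)
    (hr : RootedFace (dom Dl) (w.side .W) f₀) (habove : w.2 < f₀.2) (hcol : w.1 ≤ f₀.1)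
    (hphase : ∀ (ω : ΩG (dom Dl) (w.side .W) f₀) (h : ω.IsB2a), ω.AJ hr h (toC (midPt (w.side .W))) ≠ 0 →
      arcKind (ω.2.sIn ω.2.firstHitG) (ω.2.sOut ω.2.firstHitG) ≠ .straight →
        cost (slotOfSide (ω.ext₃ hr).1) (ω.ext₃ hr).2.mids = 5 →
          phaseIndex (ω.ext₃ hr).2.mids = 3 ∨ phaseIndex (ω.ext₃ hr).2.mids = 6)
    (hex : ∃ (ω : ΩG (dom Dl) (w.side .W) f₀) (h : ω.IsB2a), ω.AJ hr h (toC (midPt (w.side .W))) ≠ 0 ∧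
      arcKind (ω.2.sIn ω.2.firstHitG) (ω.2.sOut ω.2.firstHitG) ≠ .straight ∧
        cost (slotOfSide (ω.ext₃ hr).1) (ω.ext₃ hr).2.mids = 5) :
    {θ ∈ Set.Ioo 0 π | vertexFunctional (printedWeights θ) tFiveEighths (ybCoeff θ) Dl (w.side .W) f₀ = 0}.Finite ∧
      {θ ∈ Set.Ioo 0 π | vertexFunctional (printedWeights θ) tFiveEighths (ybCoeff θ) Dl (w.side .W) f₀ = 0}.ncard ≤
        4 * maxExp Dl (w.side .W) f₀ + 1 - 5 := by
  -- membership in the wound-member set: class `B2a` and not unwound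
  have hmem : ∀ ω : ΩG (dom Dl) (w.side .W) f₀,
      ω ∈ (ΩG.setB2a (dom Dl) (w.side .W) f₀).filter (fun ω => ¬ω.Unwound hr) ↔
        ∃ h : ω.IsB2a, ω.AJ hr h (toC (midPt (w.side .W))) ≠ 0 := by
    intro ω
    rw [Finset.mem_filter, ΩG.unwound_iff_AJ_root_eq_zero]
    unfold ΩG.setB2a
    rw [Finset.mem_filter]
    simp only [Finset.mem_univ, true_and, not_forall]
    constructor
    · rintro ⟨h, ⟨h', hA⟩⟩; exact ⟨h', hA⟩
    · rintro ⟨h, hA⟩; exact ⟨h, ⟨h, hA⟩⟩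
  -- the first arc in `f₀` turns, in the walk's own sides
  have hturn : ∀ (ω : ΩG (dom Dl) (w.side .W) f₀) (h : ω.IsB2a), IsNS ω hr →
      arcKind (ω.2.sIn ω.2.firstHitG) (ω.2.sOut ω.2.firstHitG) ≠ .straight := by
    intro ω h hN
    obtain ⟨-, hf2, hf3⟩ := ΩG.fc_fh' ω hr h
    rw [hf2, hf3]; exact hN.2
  refine vertexFunctional_printed_zero_set_finite_of_aboveCoherent Dl hh hr (fun ω hω => ?_) ?_
  · obtain ⟨h, hA⟩ := (hmem ω).1 hω
    refine ⟨fun hc5 => absurd (ΩG.rootRow_of_cost_five hh hr h hA hc5 hcol) (ne_of_gt habove), fun hN hc => ?_⟩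
    have hNS := hturn ω h hN
    rcases (ΩG.cost_ext₃_eq_five_iff hr h hNS).1 hc with ⟨hc5, -⟩ | ⟨hc7, hEW⟩
    · exact absurd (ΩG.rootRow_of_cost_five hh hr h hA hc5 hcol) (ne_of_gt habove)
    · refine ⟨?_, hphase ω h hA hNS hc⟩
      rw [ΩG.ext₃_fst_eq_N_of_above hh hr h hA hc7 hEW hNS habove]; rfl
  · obtain ⟨ω, h, hA, hNS, hc⟩ := hex
    obtain ⟨-, hsInF, hsOutF⟩ := fc_fh ω hr h
    have hN : IsNS ω hr := ⟨h, by rw [← hsInF, ← hsOutF]; exact hNS⟩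
    exact ⟨ω, (hmem ω).2 ⟨h, hA⟩, Or.inr ⟨hN, hc⟩⟩

/-- ★★★★ **Hence some `θ ∈ (0, π)` has a NON-VANISHING printed vertex functional above the root row**, under the same phase hypothesis.
[cite: GlazmanManolescu2019, Lemma 2.1 and eq. (1); Remark 2.2] [cite: Glazman2015WeightedSAW, Lemma 3.1 (proof, pp. 6–7)] -/
theorem vertexFunctional_printed_exists_ne_zero_above_of_phase {w f₀ : Face} (hh : holeFaceW w ∉ dom Dl)
    (hr : RootedFace (dom Dl) (w.side .W) f₀) (habove : w.2 < f₀.2) (hcol : w.1 ≤ f₀.1)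
    (hphase : ∀ (ω : ΩG (dom Dl) (w.side .W) f₀) (h : ω.IsB2a), ω.AJ hr h (toC (midPt (w.side .W))) ≠ 0 →
      arcKind (ω.2.sIn ω.2.firstHitG) (ω.2.sOut ω.2.firstHitG) ≠ .straight →
        cost (slotOfSide (ω.ext₃ hr).1) (ω.ext₃ hr).2.mids = 5 →
          phaseIndex (ω.ext₃ hr).2.mids = 3 ∨ phaseIndex (ω.ext₃ hr).2.mids = 6)
    (hex : ∃ (ω : ΩG (dom Dl) (w.side .W) f₀) (h : ω.IsB2a), ω.AJ hr h (toC (midPt (w.side .W))) ≠ 0 ∧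
      arcKind (ω.2.sIn ω.2.firstHitG) (ω.2.sOut ω.2.firstHitG) ≠ .straight ∧
        cost (slotOfSide (ω.ext₃ hr).1) (ω.ext₃ hr).2.mids = 5) :
    ∃ θ ∈ Set.Ioo 0 π, vertexFunctional (printedWeights θ) tFiveEighths (ybCoeff θ) Dl (w.side .W) f₀ ≠ 0 := by
  obtain ⟨hfin, -⟩ := vertexFunctional_printed_zero_set_finite_above_of_phase Dl hh hr habove hcol hphase hex
  by_contra hno
  push Not at hno
  have hsub : Set.Ioo (0 : ℝ) π ⊆
      {θ ∈ Set.Ioo 0 π | vertexFunctional (printedWeights θ) tFiveEighths (ybCoeff θ) Dl (w.side .W) f₀ = 0} :=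
    fun θ hθ => ⟨hθ, hno θ hθ⟩
  exact (Set.Ioo_infinite Real.pi_pos).mono hsub |> fun hinf => hinf hfin

end Literature.Barriers.CriticalPhenomena.PlaquetteWalk
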